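import Summits.FinalStateConjecture.FinalStateConjecture.Theorems.EIHFluxBalanceRecedingWellsGreen
import Summits.FinalStateConjecture.FinalStateConjecture.Theorems.EIHFluxBalanceRecedingWellsCalculus

/-!
# Route EIHFluxBalance — `RecedingWellsEnergyBound`: finite speed of propagation for a time-dependent potential

Third helper file for the support item stmt-FinalStateConjecture-10168
(`Summit.FinalStateConjecture.FinalStateConjecture.Theses.EIHFluxBalance.RecedingWellsEnergyBound`).
For a `C²` solution `u` of `u_tt − u_xx + W(t,x) u = 0` with `W ≥ 0` continuously differentiable
and `∂ₜ W` bounded above, FORWARD uniqueness on domains of dependence holds: if `u = u_t = 0` on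
`[a, b]` at time `t₁`, then `u = 0` on the shrinking intervals `[a + (t − t₁), b − (t − t₁)]`,
`t ≥ t₁` (`eq_zero_of_data_fwd`).  The proof is Grönwall-free: the weighted energy
`∫ e^{−Kt} (u_t² + u_x² + W u² + u²)` on the shrinking interval is NON-INCREASING
(`MovingWells.trapezoid_le` applied to the pair `q = e^{−Kt}(e + u²)`, `g = −e^{−Kt} m`, whose
divergence `e^{−Kt}(−K(e + u²) + W_t u² + 2 u u_t)` is `≤ 0` once `K ≥ sup W_t + 1`, and whose
end fluxes have the good sign because `|m| ≤ e`), vanishes initially, and dominates `e^{−Kt} u²`.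
Corollaries in the form used downstream: outside the forward light cone of compactly supported
data (`|y| ≥ R₁ + s`, `s ≥ 0`) the solution and all its first partials vanish
(`eq_zero_right_of_data_fwd`, `eq_zero_left_of_data_fwd`, `eq_zero_of_abs_ge`).
Standard material [folklore].
-/

namespace Summit.FinalStateConjecture.FinalStateConjecture.Theorems

open MeasureTheory Set Filter Topology intervalIntegral

noncomputable section

namespace MovingWells

open WaveEnergy

variable {u W : ℝ × ℝ → ℝ}

/-- Partials of the Grönwall weight `ρ(t, x) = e^{−Kt}`: `ρ_t = −K ρ`, `ρ_x = 0`. -/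
theorem fderiv_expWeight (K t x : ℝ) :
    fderiv ℝ (fun z : ℝ × ℝ => Real.exp (-K * z.1)) (t, x) (1, 0) = -K * Real.exp (-K * t)
      ∧ fderiv ℝ (fun z : ℝ × ℝ => Real.exp (-K * z.1)) (t, x) (0, 1) = 0 := by
  have hρ : Differentiable ℝ (fun z : ℝ × ℝ => Real.exp (-K * z.1)) := by fun_prop
  constructor
  · have h : HasDerivAt (fun τ : ℝ => Real.exp (-K * τ)) (Real.exp (-K * t) * (-K * 1)) t :=
      (((hasDerivAt_id t).const_mul (-K))).exp
    have h' := (hasDerivAt_slice_fst hρ t x).unique h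
    rw [h']
    ring
  · have h : HasDerivAt (fun y : ℝ => (fun z : ℝ × ℝ => Real.exp (-K * z.1)) (t, y)) 0 x := by
      simpa using hasDerivAt_const x (Real.exp (-K * t))
    exact (hasDerivAt_slice_snd hρ t x).unique h

/-- A continuous function, non-negative on `[p, q]` (`p < q`) with non-positive integral, vanishes
on `[p, q]`. -/
theorem eq_zero_of_integral_nonpos {f : ℝ → ℝ} (hf : Continuous f) {p q : ℝ} (hpq : p < q)
    (h0 : ∀ x ∈ Icc p q, 0 ≤ f x) (hint : (∫ x in p..q, f x) ≤ 0) {x : ℝ} (hx : x ∈ Icc p q) :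
    f x = 0 := by
  by_contra hne
  have hpos : 0 < f x := lt_of_le_of_ne (h0 x hx) (Ne.symm hne)
  have := intervalIntegral.integral_pos hpq hf.continuousOn (fun y hy => h0 y (Ioc_subset_Icc_self hy))
    ⟨x, hx, hpos⟩
  linarith

/-- If `u (t₁, ·)` vanishes on `[a, b]`, `a < b`, then so does `u_x (t₁, ·)` (open interval by
local constancy, closed interval by continuity of the partial). -/
theorem fderiv_snd_eq_zero_of_eq_zero (hu : ContDiff ℝ 2 u) {a b t₁ : ℝ} (hab : a < b)
    (h0 : ∀ x ∈ Icc a b, u (t₁, x) = 0) {x : ℝ} (hx : x ∈ Icc a b) :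
    fderiv ℝ u (t₁, x) (0, 1) = 0 := by
  have hud := differentiable_of_contDiff_two hu
  have hux_open : ∀ y ∈ Ioo a b, fderiv ℝ u (t₁, y) (0, 1) = 0 := by
    intro y hy
    have hzero : (fun y' => u (t₁, y')) =ᶠ[𝓝 y] fun _ => (0 : ℝ) := by
      filter_upwards [Ioo_mem_nhds hy.1 hy.2] with y' hy'
      exact h0 y' (Ioo_subset_Icc_self hy')
    have hd : HasDerivAt (fun y' => u (t₁, y')) 0 y :=
      (hasDerivAt_const y (0 : ℝ)).congr_of_eventuallyEq hzero
    exact (hasDerivAt_slice_snd hud t₁ y).unique hd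
  have hcl : IsClosed {y : ℝ | fderiv ℝ u (t₁, y) (0, 1) = 0} :=
    isClosed_eq ((continuous_fderiv_apply hu (0, 1)).comp (Continuous.prodMk_right t₁))
      continuous_const
  have hsub : closure (Ioo a b) ⊆ {y : ℝ | fderiv ℝ u (t₁, y) (0, 1) = 0} :=
    hcl.closure_subset_iff.mpr hux_open
  rw [closure_Ioo hab.ne] at hsub
  exact hsub hx

/-- The pointwise inequality behind the Grönwall weight: with `K = |B| + 1`, `W_t ≤ B` and
`u_t² + u_x² ≤ e`, the source `−K(e + u²) + W_t u² + 2 u u_t` is non-positive. -/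
theorem gronwall_source_nonpos {K B Wt e ut ux w : ℝ} (hK : K = |B| + 1) (hWt : Wt ≤ B)
    (he : ut ^ 2 + ux ^ 2 ≤ e) : -K * (e + w ^ 2) + Wt * w ^ 2 + 2 * w * ut ≤ 0 := by
  have h1 : Wt * w ^ 2 ≤ |B| * w ^ 2 :=
    mul_le_mul_of_nonneg_right (hWt.trans (le_abs_self B)) (sq_nonneg _)
  have h2 : 2 * w * ut ≤ w ^ 2 + ut ^ 2 := by nlinarith [sq_nonneg (w - ut)]
  have h3 : 0 ≤ |B| := abs_nonneg B
  subst hK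
  nlinarith [mul_nonneg h3 (sq_nonneg ut), mul_nonneg h3 (sq_nonneg ux),
    mul_nonneg h3 (by linarith : 0 ≤ e - ut ^ 2 - ux ^ 2), sq_nonneg ux]

/-- **Forward finite speed of propagation (time-dependent potential).** Let `u` be a `C²`
solution of `u_tt − u_xx + W u = 0` on `ℝ × ℝ` with `W` of class `C¹`, `W ≥ 0` and `∂ₜ W ≤ B`.
If `u (t₁, ·) = u_t (t₁, ·) = 0` on `[a, b]`, then `u (t, x) = 0` whenever `t₁ ≤ t`,
`a + (t − t₁) ≤ x ≤ b − (t − t₁)` and `a + (t − t₁) < b − (t − t₁)`.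
(Monotone weighted energy `∫ e^{−Kt}(u_t² + u_x² + W u² + u²)`, `K = |B| + 1`, on the shrinking
interval.) [folklore] -/
theorem eq_zero_of_data_fwd (hu : ContDiff ℝ 2 u) (hW : ContDiff ℝ 1 W) (hW0 : ∀ z, 0 ≤ W z)
    {B : ℝ} (hB : ∀ z, fderiv ℝ W z (1, 0) ≤ B)
    (hsol : ∀ z : ℝ × ℝ, fderiv ℝ (fderiv ℝ u) z (1, 0) (1, 0)
      - fderiv ℝ (fderiv ℝ u) z (0, 1) (0, 1) + W z * u z = 0)
    {a b t₁ : ℝ} (h0 : ∀ x ∈ Icc a b, u (t₁, x) = 0)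
    (h1 : ∀ x ∈ Icc a b, fderiv ℝ u (t₁, x) (1, 0) = 0) {t x : ℝ} (ht : t₁ ≤ t)
    (hlt : a + (t - t₁) < b - (t - t₁)) (hx1 : a + (t - t₁) ≤ x) (hx2 : x ≤ b - (t - t₁)) :
    u (t, x) = 0 := by
  have hWd : Differentiable ℝ W := hW.differentiable (by norm_num)
  have hud := differentiable_of_contDiff_two hu
  set K : ℝ := |B| + 1 with hK
  -- densities
  set e : ℝ × ℝ → ℝ := fun z =>
    (fderiv ℝ u z (1, 0)) ^ 2 + (fderiv ℝ u z (0, 1)) ^ 2 + W z * u z ^ 2 with he_def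
  set m : ℝ × ℝ → ℝ := fun z => 2 * fderiv ℝ u z (1, 0) * fderiv ℝ u z (0, 1) with hm_def
  set n : ℝ × ℝ → ℝ := fun z =>
    (fderiv ℝ u z (1, 0)) ^ 2 + (fderiv ℝ u z (0, 1)) ^ 2 - W z * u z ^ 2 with hn_def
  have he : ∀ z, e z = (fderiv ℝ u z (1, 0)) ^ 2 + (fderiv ℝ u z (0, 1)) ^ 2 + W z * u z ^ 2 :=
    fun z => rfl
  have hm : ∀ z, m z = 2 * fderiv ℝ u z (1, 0) * fderiv ℝ u z (0, 1) := fun z => rfl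
  have hn : ∀ z, n z = (fderiv ℝ u z (1, 0)) ^ 2 + (fderiv ℝ u z (0, 1)) ^ 2 - W z * u z ^ 2 :=
    fun z => rfl
  set ρ : ℝ × ℝ → ℝ := fun z => Real.exp (-K * z.1) with hρ_def
  have hρd : Differentiable ℝ ρ := by simp only [hρ_def]; fun_prop
  set q : ℝ × ℝ → ℝ := fun z => ρ z * e z + ρ z * u z ^ 2 + (0 : ℝ) * m z with hq_def
  set g : ℝ × ℝ → ℝ := fun z => -(ρ z * m z + (0 : ℝ) * n z) with hg_def
  have hq : ∀ z, q z = ρ z * e z + ρ z * u z ^ 2 + (fun _ => (0 : ℝ)) z * m z := fun z => rfl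
  have hg : ∀ z, g z = -(ρ z * m z + (fun _ => (0 : ℝ)) z * n z) := fun z => rfl
  have hqd := differentiable_weighted hu hWd he hm hρd hρd (differentiable_const 0) hq
  have hgd := differentiable_weightedFlux hu hWd hm hn hρd (differentiable_const 0) hg
  -- the source and its sign
  set d : ℝ × ℝ → ℝ := fun z => ρ z * (-K * (e z + u z ^ 2)
    + fderiv ℝ W z (1, 0) * u z ^ 2 + 2 * u z * fderiv ℝ u z (1, 0)) with hd_def
  have hdiv : ∀ z, fderiv ℝ q z (1, 0) + fderiv ℝ g z (0, 1) = d z := by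
    intro z
    rw [divergence_weighted hu hWd hsol he hm hn hρd hρd (differentiable_const 0) hq hg z]
    obtain ⟨t', x'⟩ := z
    have h1 : fderiv ℝ ρ (t', x') (1, 0) = -K * ρ (t', x') := (fderiv_expWeight K t' x').1
    have h2 : fderiv ℝ ρ (t', x') (0, 1) = 0 := (fderiv_expWeight K t' x').2
    have h0 : fderiv ℝ (fun _ : ℝ × ℝ => (0 : ℝ)) (t', x') = 0 := by simp
    simp only [hd_def, h1, h2, h0, zero_apply, zero_mul, add_zero]
    ring
  have hdc : Continuous d := by
    have h1 := continuous_fderiv_apply hu (1, 0)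
    have h2 := continuous_energy hu hW.continuous he
    have h3 : Continuous fun z : ℝ × ℝ => fderiv ℝ W z (1, 0) :=
      (hW.continuous_fderiv (by norm_num)).clm_apply continuous_const
    simp only [hd_def, hρ_def]
    fun_prop
  have hdneg : ∀ z, d z ≤ 0 := fun z =>
    mul_nonpos_of_nonneg_of_nonpos (Real.exp_pos _).le
      (gronwall_source_nonpos hK (hB z) (kinetic_le_energy hW0 he z))
  -- the weighted energy on the shrinking interval does not increase
  have key := trapezoid_le hqd hgd hdc hdiv (a - t₁) 1 (b + t₁) (-1) ht
    (fun s hs => by linarith [hs.2]) (fun s _ y _ => hdneg (s, y))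
  have e1 : a - t₁ + 1 * t = a + (t - t₁) := by ring
  have e2 : b + t₁ + -1 * t = b - (t - t₁) := by ring
  have e3 : a - t₁ + 1 * t₁ = a := by ring
  have e4 : b + t₁ + -1 * t₁ = b := by ring
  rw [e1, e2, e3, e4] at key
  -- boundary fluxes have the good sign
  have hbdry : (∫ s in t₁..t, ((-1 * q (s, b + t₁ + -1 * s) - g (s, b + t₁ + -1 * s))
      - (1 * q (s, a - t₁ + 1 * s) - g (s, a - t₁ + 1 * s)))) ≤ 0 := by
    refine intervalIntegral_nonpos_of_le ht fun s _ => ?_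
    have hA : ∀ z, -1 * q z - g z ≤ 0 := by
      intro z
      have h1 := momentum_le_kinetic hm z
      have h2 := kinetic_le_energy hW0 he z
      have hρpos : 0 < ρ z := Real.exp_pos _
      have : -1 * q z - g z = ρ z * (m z - e z - u z ^ 2) := by
        simp only [hq_def, hg_def]; ring
      rw [this]
      exact mul_nonpos_of_nonneg_of_nonpos hρpos.le (by nlinarith [sq_nonneg (u z)])
    have hB' : ∀ z, 0 ≤ 1 * q z - g z := by
      intro z
      have h1 := neg_momentum_le_kinetic hm z
      have h2 := kinetic_le_energy hW0 he z
      have hρpos : 0 < ρ z := Real.exp_pos _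
      have : 1 * q z - g z = ρ z * (e z + u z ^ 2 + m z) := by
        simp only [hq_def, hg_def]; ring
      rw [this]
      exact mul_nonneg hρpos.le (by nlinarith [sq_nonneg (u z)])
    linarith [hA (s, b + t₁ + -1 * s), hB' (s, a - t₁ + 1 * s)]
  -- the initial weighted energy vanishes
  have hab : a < b := by linarith
  have hinit : (∫ y in a..b, q (t₁, y)) = 0 := by
    rw [intervalIntegral.integral_congr (g := fun _ => (0 : ℝ)) (fun y hy => ?_)]
    · simp
    · rw [uIcc_of_le hab.le] at hy
      have hux := fderiv_snd_eq_zero_of_eq_zero hu hab h0 hy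
      simp only [hq_def, he_def, hm_def, h0 y hy, h1 y hy, hux]
      ring
  rw [hinit] at key
  -- so the weighted energy at time `t` is `≤ 0`, and its density vanishes
  have hle : (∫ y in (a + (t - t₁))..(b - (t - t₁)), q (t, y)) ≤ 0 := by linarith
  have hqc : Continuous fun y => q (t, y) := hqd.continuous.comp (Continuous.prodMk_right t)
  have hq0 : ∀ z, 0 ≤ q z := by
    intro z
    have h2 := WaveDefect.energyDensity_nonneg hW0 he z
    have hρpos : 0 < ρ z := Real.exp_pos _
    simp only [hq_def]
    nlinarith [mul_nonneg hρpos.le h2, mul_nonneg hρpos.le (sq_nonneg (u z))]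
  have hqz := eq_zero_of_integral_nonpos hqc hlt (fun y _ => hq0 (t, y)) hle ⟨hx1, hx2⟩
  have hρpos : 0 < ρ (t, x) := Real.exp_pos _
  have h2 := WaveDefect.energyDensity_nonneg hW0 he (t, x)
  have hsq : ρ (t, x) * u (t, x) ^ 2 = 0 := by
    simp only [hq_def] at hqz
    nlinarith [mul_nonneg hρpos.le h2, mul_nonneg hρpos.le (sq_nonneg (u (t, x)))]
  rcases mul_eq_zero.mp hsq with h | h
  · exact absurd h hρpos.ne'
  · exact pow_eq_zero_iff (n := 2) (by norm_num) |>.mp h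

/-- **Right of the forward light cone.** Under the hypotheses of `eq_zero_of_data_fwd`, if the
data vanish on `[c, ∞)` at time `0` then at every point with `0 ≤ s` and `c + s ≤ y` the solution
and all its first partials vanish (interior points: `u ≡ 0` nearby; boundary points: by
continuity of the partials along `ε ↦ (s + ε, y + 2ε)`). [folklore] -/
theorem eq_zero_right_of_data_fwd (hu : ContDiff ℝ 2 u) (hW : ContDiff ℝ 1 W) (hW0 : ∀ z, 0 ≤ W z)
    {B : ℝ} (hB : ∀ z, fderiv ℝ W z (1, 0) ≤ B)
    (hsol : ∀ z : ℝ × ℝ, fderiv ℝ (fderiv ℝ u) z (1, 0) (1, 0)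
      - fderiv ℝ (fderiv ℝ u) z (0, 1) (0, 1) + W z * u z = 0)
    {c : ℝ} (h0 : ∀ y, c ≤ y → u (0, y) = 0) (h1 : ∀ y, c ≤ y → fderiv ℝ u (0, y) (1, 0) = 0)
    {s y : ℝ} (hs : 0 ≤ s) (hy : c + s ≤ y) (w : ℝ × ℝ) :
    u (s, y) = 0 ∧ fderiv ℝ u (s, y) w = 0 := by
  have hzero : ∀ s' y' : ℝ, 0 ≤ s' → c + s' ≤ y' → u (s', y') = 0 := by
    intro s' y' hs' hy'
    refine eq_zero_of_data_fwd hu hW hW0 hB hsol (a := c) (b := y' + s' + 1) (t₁ := 0)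
      (fun x hx => h0 x hx.1) (fun x hx => h1 x hx.1) hs' ?_ ?_ ?_ <;> linarith
  refine ⟨hzero s y hs hy, ?_⟩
  have hopen : IsOpen {z : ℝ × ℝ | 0 < z.1 ∧ c + z.1 < z.2} :=
    (isOpen_lt continuous_const continuous_fst).inter
      (isOpen_lt (continuous_const.add continuous_fst) continuous_snd)
  have hint : ∀ ε : ℝ, 0 < ε → fderiv ℝ u (s + ε, y + 2 * ε) w = 0 := by
    intro ε hε
    have hev : u =ᶠ[𝓝 (s + ε, y + 2 * ε)] fun _ => 0 := by
      filter_upwards [hopen.mem_nhds (show (0 : ℝ) < (s + ε, y + 2 * ε).1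
          ∧ c + (s + ε, y + 2 * ε).1 < (s + ε, y + 2 * ε).2 by
        simp only; constructor <;> linarith)] with z hz
      exact hzero z.1 z.2 hz.1.le hz.2.le
    rw [hev.fderiv_eq]
    simp
  have hcl : IsClosed {ε : ℝ | fderiv ℝ u (s + ε, y + 2 * ε) w = 0} :=
    isClosed_eq ((continuous_fderiv_apply hu w).comp
      ((continuous_const.add continuous_id).prodMk
        (continuous_const.add (continuous_const.mul continuous_id)))) continuous_const
  have hsub := hcl.closure_subset_iff.mpr (fun ε (hε : ε ∈ Ioi (0 : ℝ)) => hint ε hε)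
  rw [closure_Ioi] at hsub
  simpa using hsub (mem_Ici.mpr le_rfl)

/-- **Left of the forward light cone.** If the data vanish on `(−∞, c]` at time `0`, then at
every point with `0 ≤ s` and `y ≤ c − s` the solution and all its first partials vanish.
[folklore] -/
theorem eq_zero_left_of_data_fwd (hu : ContDiff ℝ 2 u) (hW : ContDiff ℝ 1 W) (hW0 : ∀ z, 0 ≤ W z)
    {B : ℝ} (hB : ∀ z, fderiv ℝ W z (1, 0) ≤ B)
    (hsol : ∀ z : ℝ × ℝ, fderiv ℝ (fderiv ℝ u) z (1, 0) (1, 0)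
      - fderiv ℝ (fderiv ℝ u) z (0, 1) (0, 1) + W z * u z = 0)
    {c : ℝ} (h0 : ∀ y, y ≤ c → u (0, y) = 0) (h1 : ∀ y, y ≤ c → fderiv ℝ u (0, y) (1, 0) = 0)
    {s y : ℝ} (hs : 0 ≤ s) (hy : y ≤ c - s) (w : ℝ × ℝ) :
    u (s, y) = 0 ∧ fderiv ℝ u (s, y) w = 0 := by
  have hzero : ∀ s' y' : ℝ, 0 ≤ s' → y' ≤ c - s' → u (s', y') = 0 := by
    intro s' y' hs' hy'
    refine eq_zero_of_data_fwd hu hW hW0 hB hsol (a := y' - s' - 1) (b := c) (t₁ := 0)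
      (fun x hx => h0 x hx.2) (fun x hx => h1 x hx.2) hs' ?_ ?_ ?_ <;> linarith
  refine ⟨hzero s y hs hy, ?_⟩
  have hopen : IsOpen {z : ℝ × ℝ | 0 < z.1 ∧ z.2 < c - z.1} :=
    (isOpen_lt continuous_const continuous_fst).inter
      (isOpen_lt continuous_snd (continuous_const.sub continuous_fst))
  have hint : ∀ ε : ℝ, 0 < ε → fderiv ℝ u (s + ε, y - 2 * ε) w = 0 := by
    intro ε hε
    have hev : u =ᶠ[𝓝 (s + ε, y - 2 * ε)] fun _ => 0 := by
      filter_upwards [hopen.mem_nhds (show (0 : ℝ) < (s + ε, y - 2 * ε).1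
          ∧ (s + ε, y - 2 * ε).2 < c - (s + ε, y - 2 * ε).1 by
        simp only; constructor <;> linarith)] with z hz
      exact hzero z.1 z.2 hz.1.le hz.2.le
    rw [hev.fderiv_eq]
    simp
  have hcl : IsClosed {ε : ℝ | fderiv ℝ u (s + ε, y - 2 * ε) w = 0} :=
    isClosed_eq ((continuous_fderiv_apply hu w).comp
      ((continuous_const.add continuous_id).prodMk
        (continuous_const.sub (continuous_const.mul continuous_id)))) continuous_const
  have hsub := hcl.closure_subset_iff.mpr (fun ε (hε : ε ∈ Ioi (0 : ℝ)) => hint ε hε)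
  rw [closure_Ioi] at hsub
  simpa using hsub (mem_Ici.mpr le_rfl)

/-- **Outside the forward light cone of compactly supported data.** If the data vanish for
`|y| ≥ R₁` at time `0`, then for `0 ≤ s` and `R₁ + s ≤ |y|` the solution and all its first
partials vanish. [folklore] -/
theorem eq_zero_of_abs_ge (hu : ContDiff ℝ 2 u) (hW : ContDiff ℝ 1 W) (hW0 : ∀ z, 0 ≤ W z)
    {B : ℝ} (hB : ∀ z, fderiv ℝ W z (1, 0) ≤ B)
    (hsol : ∀ z : ℝ × ℝ, fderiv ℝ (fderiv ℝ u) z (1, 0) (1, 0)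
      - fderiv ℝ (fderiv ℝ u) z (0, 1) (0, 1) + W z * u z = 0)
    {R₁ : ℝ} (hdata : ∀ y, R₁ ≤ |y| → u (0, y) = 0 ∧ fderiv ℝ u (0, y) (1, 0) = 0)
    {s y : ℝ} (hs : 0 ≤ s) (hy : R₁ + s ≤ |y|) (w : ℝ × ℝ) :
    u (s, y) = 0 ∧ fderiv ℝ u (s, y) w = 0 := by
  rcases le_or_gt 0 y with h | h
  · rw [abs_of_nonneg h] at hy
    exact eq_zero_right_of_data_fwd hu hW hW0 hB hsol (c := R₁)
      (fun y' hy' => (hdata y' (hy'.trans (le_abs_self y'))).1)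
      (fun y' hy' => (hdata y' (hy'.trans (le_abs_self y'))).2) hs hy w
  · rw [abs_of_neg h] at hy
    exact eq_zero_left_of_data_fwd hu hW hW0 hB hsol (c := -R₁)
      (fun y' hy' => (hdata y' (by linarith [neg_le_abs y'])).1)
      (fun y' hy' => (hdata y' (by linarith [neg_le_abs y'])).2) hs (by linarith) w

end MovingWells

end

end Summit.FinalStateConjecture.FinalStateConjecture.Theorems
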